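import Literature.Probability.LatticeModels.FieldScalingLimitTrivialityProofs
import Literature.Probability.LatticeModels.GibbsStatesProofs
import Literature.Probability.LatticeModels.PlusMinusStateGibbs
import HarnessLib

/-!
# crit-ising.S13 in its plus-box rendering: reduction to the infinite-volume theorem

Second proof companion of `Literature/Probability/LatticeModels/FieldScalingLimit.lean` for
`Literature.Probability.LatticeModels.highDim_triviality` (theorems only: no definition, no
statement and no named fact is introduced or changed).

`highDim_triviality` smears the FINITE-VOLUME PLUS-boundary-condition measures
`isingMeasure (zdGraph d) (box d (L δ)) (β δ) 0 .plus` (`isingFieldLaw`), whereas every source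
(Aizenman–Duminil-Copin, Ann. Math. 194 (2021) = arXiv:1912.07973, Def. 1.1 / Thm 1.2, p. 4,
Prop. 1.4, p. 6; Aizenman, CMP 86 (1982), (13.1); Panis 2023, Thm 5.5) treats the infinite-volume
state; the corrected, infinite-volume form is proved in `FieldScalingLimitTrivialityProofs.lean`
(`highDim_triviality_gibbs_of_five_le`, `highDim_triviality_gibbs`; provefact verdict `misstated`,
2026-08-15). This file isolates, as a theorem, exactly what separates the rendered statement from
the printed one: the plus-box laws and the laws smeared from the zero-field DLR state have
generating functionals within twice the **renormalised plus-boundary magnetisation functional**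
`M_δ(f) = ∑_{x ∈ Λ_δ} |ρ(δ) δᵈ f(δx)| ⟨σₓ⟩⁺_{Λ_δ; β(δ), 0}`, `Λ_δ = box d (L δ)`
(`norm_genFunctional_isingFieldLaw_sub_spinFieldLaw_le`), so that `highDim_triviality` holds along
every family of parameters for which `M_δ(f) → 0` for all test functions `f`
(`highDim_triviality_plus_of_five_le`, `d ≥ 5`, otherwise unconditional;
`highDim_triviality_plus`, `d ≥ 4`, from the named fact `panis_ursellFourSum_le_four` exactly as
the corrected form). The comparison is the FKG–Lipschitz argument: for a `1`-Lipschitz `F` and a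
linear spin observable `X = ∑ cₓ σₓ`, the observables `∑ |cₓ| σₓ ± F(X)` are nondecreasing, so
the finite-volume FKG sandwich `ν(g) ≤ μ⁺_Λ(g)` for nondecreasing local `g` and every DLR state `ν`
(Friedli–Velenik 2017, proof of Lemma 6.65, eq. (6.70), p. 311, with Lemma 3.23, p. 112 — the
tree's `integral_le_isingExpect_plus_of_isGibbsMeasure`) gives
`|μ⁺_Λ(F(X)) − ν(F(X))| ≤ ∑ |cₓ| (⟨σₓ⟩⁺_Λ − ν(σₓ))`, and `ν(σₓ) = 0` for the (unique, even)
zero-field state at `β ≤ β_c` (`measurePreserving_neg_of_mem_isingGibbsMeasures`). Finally the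
functional condition is reduced to two scalar conditions on the parameters —
`ρ(δ) ⟨σ₀⟩⁺_{box d ⌊L(δ)/2⌋; β(δ), 0} → 0` and `ρ(δ) (δ L(δ))^{-N} → 0` for some `N`
(`tendsto_plusBoundaryMagnetization_of_center`: translation covariance and FKG volume
monotonicity of the plus boxes inside the half-box, Schwartz decay outside it), giving
`highDim_triviality_plus_of_center_of_five_le` / `highDim_triviality_plus_of_center`. What the
sources do not print, and this file does not prove, is that these conditions follow from the
a-posteriori hypothesis `HasBoundedNondegenerateTwoPoint μ` in the joint regime `δ L(δ) → ∞`.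

References: S. Friedli, Y. Velenik, *Statistical Mechanics of Lattice Systems* (CUP 2017),
Lemma 3.23 (p. 112), Thm. 3.21 (FKG), §6.8.3 eq. (6.70) (p. 311); M. Aizenman, H. Duminil-Copin,
Ann. Math. 194 (2021), Def. 1.1, Thm 1.2 (arXiv:1912.07973, p. 4). All auxiliary statements are
proof devices ([folklore]); no definitions and no new named facts are introduced (D-0026).
-/

noncomputable section

open scoped SchwartzMap
open MeasureTheory Filter Topology ProbabilityTheory Complex
open Literature.MathematicalPhysics.QuantumLattice
open Literature.MathematicalPhysics.QuantumFieldTheory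

namespace Literature.Probability.LatticeModels

variable {d : ℕ}

/-! ### Lipschitz functions of a linear spin observable are differences of nondecreasing ones -/

section Lipschitz

variable {V : Type*}

/-- For coefficients `c` and configurations `σ ≤ τ` (coordinatewise, `-1 < 1`), the linear spin
observable `X = ∑_{x ∈ Λ} cₓ σₓ` changes by at most the change of its majorant
`X⁺ = ∑_{x ∈ Λ} |cₓ| σₓ`: `|X(τ) − X(σ)| ≤ X⁺(τ) − X⁺(σ)`. [folklore] -/
theorem abs_sum_mul_spinAt_sub_le (Λ : Finset V) (c : V → ℝ) {σ τ : SpinConfig V} (h : σ ≤ τ) :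
    |∑ x ∈ Λ, c x * spinAt x τ - ∑ x ∈ Λ, c x * spinAt x σ| ≤
      ∑ x ∈ Λ, |c x| * spinAt x τ - ∑ x ∈ Λ, |c x| * spinAt x σ := by
  rw [← Finset.sum_sub_distrib, ← Finset.sum_sub_distrib]
  refine (Finset.abs_sum_le_sum_abs _ _).trans (Finset.sum_le_sum fun x _ => ?_)
  rw [← mul_sub, ← mul_sub, abs_mul, abs_of_nonneg (sub_nonneg.2 (spinAt_mono x h))]

/-- **FKG–Lipschitz device.** For a `1`-Lipschitz `F : ℝ → ℝ` and a linear spin observable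
`X = ∑_{x ∈ Λ} cₓ σₓ` with majorant `X⁺ = ∑_{x ∈ Λ} |cₓ| σₓ`, both `X⁺ + F(X)` and `X⁺ − F(X)` are
nondecreasing for the coordinatewise order on `{−1,+1}^V` (the order of the FKG inequality,
Friedli–Velenik 2017, §3.6.2). [folklore] -/
theorem monotone_sum_abs_mul_spinAt_add_sub_comp (Λ : Finset V) (c : V → ℝ) {F : ℝ → ℝ}
    (hF : ∀ a b : ℝ, |F b - F a| ≤ |b - a|) :
    Monotone (fun σ : SpinConfig V =>
        ∑ x ∈ Λ, |c x| * spinAt x σ + F (∑ x ∈ Λ, c x * spinAt x σ)) ∧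
      Monotone (fun σ : SpinConfig V =>
        ∑ x ∈ Λ, |c x| * spinAt x σ - F (∑ x ∈ Λ, c x * spinAt x σ)) := by
  refine ⟨fun σ τ hστ => ?_, fun σ τ hστ => ?_⟩
  · have h1 := abs_sum_mul_spinAt_sub_le Λ c hστ
    have h2 := hF (∑ x ∈ Λ, c x * spinAt x σ) (∑ x ∈ Λ, c x * spinAt x τ)
    have h3 := neg_abs_le (F (∑ x ∈ Λ, c x * spinAt x τ) - F (∑ x ∈ Λ, c x * spinAt x σ))
    dsimp only
    linarith
  · have h1 := abs_sum_mul_spinAt_sub_le Λ c hστ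
    have h2 := hF (∑ x ∈ Λ, c x * spinAt x σ) (∑ x ∈ Λ, c x * spinAt x τ)
    have h3 := le_abs_self (F (∑ x ∈ Λ, c x * spinAt x τ) - F (∑ x ∈ Λ, c x * spinAt x σ))
    dsimp only
    linarith

/-- The linear spin observable `σ ↦ ∑_{x ∈ Λ} cₓ σₓ` is measurable. [folklore] -/
@[fun_prop]
theorem measurable_finsetSum_mul_spinAt (Λ : Finset V) (c : V → ℝ) :
    Measurable fun σ : SpinConfig V => ∑ x ∈ Λ, c x * spinAt x σ :=
  Finset.measurable_sum _ fun x _ => (measurable_spinAt x).const_mul _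

/-- `|∑_{x ∈ Λ} cₓ σₓ| ≤ ∑_{x ∈ Λ} |cₓ|` since `|σₓ| = 1`. [folklore] -/
theorem abs_sum_mul_spinAt_le (Λ : Finset V) (c : V → ℝ) (σ : SpinConfig V) :
    |∑ x ∈ Λ, c x * spinAt x σ| ≤ ∑ x ∈ Λ, |c x| :=
  (Finset.abs_sum_le_sum_abs _ _).trans (le_of_eq (Finset.sum_congr rfl fun x _ => by
    rw [abs_mul, abs_spinAt, mul_one]))

end Lipschitz

/-! ### Comparison of two states ordered on nondecreasing observables -/

section Comparison

variable {V : Type*}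

/-- **Expectations of Lipschitz observables under FKG-ordered states.** If `Q(φ) ≤ P(φ)` for all
nondecreasing measurable `φ`, and `G ± g` are nondecreasing (with `g`, `G` integrable), then
`|P(g) − Q(g)| ≤ P(G) − Q(G)`. [folklore] -/
theorem abs_integral_sub_integral_le_of_forall_monotone {P Q : Measure (SpinConfig V)}
    (hPQ : ∀ φ : SpinConfig V → ℝ, Monotone φ → Measurable φ → ∫ σ, φ σ ∂Q ≤ ∫ σ, φ σ ∂P)
    {g G : SpinConfig V → ℝ} (hg : Measurable g) (hG : Measurable G)
    (hgP : Integrable g P) (hgQ : Integrable g Q) (hGP : Integrable G P) (hGQ : Integrable G Q)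
    (hmono : Monotone (fun σ => G σ + g σ) ∧ Monotone (fun σ => G σ - g σ)) :
    |∫ σ, g σ ∂P - ∫ σ, g σ ∂Q| ≤ ∫ σ, G σ ∂P - ∫ σ, G σ ∂Q := by
  have h1 := hPQ _ hmono.1 (hG.add hg)
  have h2 := hPQ _ hmono.2 (hG.sub hg)
  rw [integral_add hGQ hgQ, integral_add hGP hgP] at h1
  rw [integral_sub hGQ hgQ, integral_sub hGP hgP] at h2
  rw [abs_sub_le_iff]
  constructor <;> linarith

/-- The characteristic function of a linear spin observable `X = ∑_{x ∈ Λ} cₓ σₓ` under a finite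
measure, split into real and imaginary parts: `∫ e^{iX} = ∫ cos X + i ∫ sin X`. [folklore] -/
theorem integral_cexp_sum_mul_spinAt (P : Measure (SpinConfig V)) [IsFiniteMeasure P]
    (Λ : Finset V) (c : V → ℝ) :
    ∫ σ, cexp (I * ((∑ x ∈ Λ, c x * spinAt x σ : ℝ) : ℂ)) ∂P =
      ((∫ σ, Real.cos (∑ x ∈ Λ, c x * spinAt x σ) ∂P : ℝ) : ℂ) +
        ((∫ σ, Real.sin (∑ x ∈ Λ, c x * spinAt x σ) ∂P : ℝ) : ℂ) * I := by
  have hX : Measurable fun σ : SpinConfig V => ∑ x ∈ Λ, c x * spinAt x σ :=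
    measurable_finsetSum_mul_spinAt Λ c
  have hcos : Integrable (fun σ : SpinConfig V =>
      ((Real.cos (∑ x ∈ Λ, c x * spinAt x σ) : ℝ) : ℂ)) P := by
    refine Integrable.of_bound
      (Complex.measurable_ofReal.comp (Real.continuous_cos.measurable.comp hX)).aestronglyMeasurable
      1 (Eventually.of_forall fun σ => ?_)
    rw [Complex.norm_real, Real.norm_eq_abs]
    exact Real.abs_cos_le_one _
  have hsin : Integrable (fun σ : SpinConfig V =>
      ((Real.sin (∑ x ∈ Λ, c x * spinAt x σ) : ℝ) : ℂ) * I) P := by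
    refine Integrable.of_bound
      ((Complex.measurable_ofReal.comp (Real.continuous_sin.measurable.comp hX)).mul_const
        I).aestronglyMeasurable 1 (Eventually.of_forall fun σ => ?_)
    rw [norm_mul, Complex.norm_I, mul_one, Complex.norm_real, Real.norm_eq_abs]
    exact Real.abs_sin_le_one _
  have hpt : ∀ σ : SpinConfig V, cexp (I * ((∑ x ∈ Λ, c x * spinAt x σ : ℝ) : ℂ)) =
      ((Real.cos (∑ x ∈ Λ, c x * spinAt x σ) : ℝ) : ℂ) +
        ((Real.sin (∑ x ∈ Λ, c x * spinAt x σ) : ℝ) : ℂ) * I := fun σ => by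
    rw [mul_comm, Complex.exp_mul_I, Complex.ofReal_cos, Complex.ofReal_sin]
  simp_rw [hpt]
  rw [integral_add hcos hsin, integral_mul_const, integral_complex_ofReal, integral_complex_ofReal]

/-- **The FKG–Lipschitz comparison of characteristic functions.** If `Q(φ) ≤ P(φ)` for all
nondecreasing measurable `φ` (two finite measures on `{−1,+1}^V`), then for every linear spin
observable `X = ∑_{x ∈ Λ} cₓ σₓ`,
`‖P(e^{iX}) − Q(e^{iX})‖ ≤ 2 (P(X⁺) − Q(X⁺))`, `X⁺ = ∑_{x ∈ Λ} |cₓ| σₓ` (apply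
`abs_integral_sub_integral_le_of_forall_monotone` to `cos X` and `sin X`, both `1`-Lipschitz in
`X`). [folklore] -/
theorem norm_integral_cexp_sub_le_of_forall_monotone {P Q : Measure (SpinConfig V)}
    [IsFiniteMeasure P] [IsFiniteMeasure Q]
    (hPQ : ∀ φ : SpinConfig V → ℝ, Monotone φ → Measurable φ → ∫ σ, φ σ ∂Q ≤ ∫ σ, φ σ ∂P)
    (Λ : Finset V) (c : V → ℝ) :
    ‖(∫ σ, cexp (I * ((∑ x ∈ Λ, c x * spinAt x σ : ℝ) : ℂ)) ∂P) -
        ∫ σ, cexp (I * ((∑ x ∈ Λ, c x * spinAt x σ : ℝ) : ℂ)) ∂Q‖ ≤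
      2 * ((∫ σ, ∑ x ∈ Λ, |c x| * spinAt x σ ∂P) - ∫ σ, ∑ x ∈ Λ, |c x| * spinAt x σ ∂Q) := by
  -- split the characteristic functions into real and imaginary parts
  rw [integral_cexp_sum_mul_spinAt P Λ c, integral_cexp_sum_mul_spinAt Q Λ c]
  set X : SpinConfig V → ℝ := fun σ => ∑ x ∈ Λ, c x * spinAt x σ with hXdef
  set G : SpinConfig V → ℝ := fun σ => ∑ x ∈ Λ, |c x| * spinAt x σ with hGdef
  have hX : Measurable X := measurable_finsetSum_mul_spinAt Λ c
  have hG : Measurable G := measurable_finsetSum_mul_spinAt Λ (fun x => |c x|)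
  have hGb : ∀ σ, ‖G σ‖ ≤ ∑ x ∈ Λ, |c x| := fun σ => by
    rw [Real.norm_eq_abs]
    refine (abs_sum_mul_spinAt_le Λ (fun x => |c x|) σ).trans (le_of_eq ?_)
    exact Finset.sum_congr rfl fun x _ => abs_abs _
  have hGint : ∀ (P' : Measure (SpinConfig V)) [IsFiniteMeasure P'], Integrable G P' :=
    fun P' _ => Integrable.of_bound hG.aestronglyMeasurable _ (Eventually.of_forall hGb)
  have hcosint : ∀ (P' : Measure (SpinConfig V)) [IsFiniteMeasure P'],
      Integrable (fun σ => Real.cos (X σ)) P' := fun P' _ =>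
    Integrable.of_bound (Real.continuous_cos.measurable.comp hX).aestronglyMeasurable 1
      (Eventually.of_forall fun σ => by
        rw [Real.norm_eq_abs]; exact Real.abs_cos_le_one _)
  have hsinint : ∀ (P' : Measure (SpinConfig V)) [IsFiniteMeasure P'],
      Integrable (fun σ => Real.sin (X σ)) P' := fun P' _ =>
    Integrable.of_bound (Real.continuous_sin.measurable.comp hX).aestronglyMeasurable 1
      (Eventually.of_forall fun σ => by
        rw [Real.norm_eq_abs]; exact Real.abs_sin_le_one _)
  -- the two Lipschitz estimates
  have hcos : |(∫ σ, Real.cos (X σ) ∂P) - ∫ σ, Real.cos (X σ) ∂Q| ≤ (∫ σ, G σ ∂P) - ∫ σ, G σ ∂Q :=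
    abs_integral_sub_integral_le_of_forall_monotone hPQ (Real.continuous_cos.measurable.comp hX)
      hG (hcosint P) (hcosint Q) (hGint P) (hGint Q)
      (monotone_sum_abs_mul_spinAt_add_sub_comp Λ c fun a b => Real.abs_cos_sub_cos_le b a)
  have hsin : |(∫ σ, Real.sin (X σ) ∂P) - ∫ σ, Real.sin (X σ) ∂Q| ≤ (∫ σ, G σ ∂P) - ∫ σ, G σ ∂Q :=
    abs_integral_sub_integral_le_of_forall_monotone hPQ (Real.continuous_sin.measurable.comp hX)
      hG (hsinint P) (hsinint Q) (hGint P) (hGint Q)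
      (monotone_sum_abs_mul_spinAt_add_sub_comp Λ c fun a b => Real.abs_sin_sub_sin_le b a)
  set a : ℝ := (∫ σ, Real.cos (X σ) ∂P) - ∫ σ, Real.cos (X σ) ∂Q with ha
  set b : ℝ := (∫ σ, Real.sin (X σ) ∂P) - ∫ σ, Real.sin (X σ) ∂Q with hb
  have hrw : ((∫ σ, Real.cos (X σ) ∂P : ℝ) : ℂ) + ((∫ σ, Real.sin (X σ) ∂P : ℝ) : ℂ) * I -
      (((∫ σ, Real.cos (X σ) ∂Q : ℝ) : ℂ) + ((∫ σ, Real.sin (X σ) ∂Q : ℝ) : ℂ) * I) =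
        (a : ℂ) + (b : ℂ) * I := by
    rw [ha, hb]
    push_cast
    ring
  rw [hrw]
  calc ‖(a : ℂ) + (b : ℂ) * I‖ ≤ ‖(a : ℂ)‖ + ‖(b : ℂ) * I‖ := norm_add_le _ _
    _ = |a| + |b| := by
        rw [norm_mul, Complex.norm_I, mul_one, Complex.norm_real, Complex.norm_real,
          Real.norm_eq_abs, Real.norm_eq_abs]
    _ ≤ 2 * ((∫ σ, G σ ∂P) - ∫ σ, G σ ∂Q) := by linarith

end Comparison

/-! ### The plus box against a DLR state -/

section Ising

variable {V : Type*} (G : SimpleGraph V) [DecidableEq V] [G.LocallyFinite] [Countable V]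

/-- **The plus box against a Gibbs measure, for characteristic functions of linear spin
observables** (FKG–Lipschitz form of Friedli–Velenik 2017, proof of Lemma 6.65, eq. (6.70),
p. 311, with Lemma 3.23, p. 112): for `β ≥ 0`, any field `h`, a DLR state `ν` of the Ising
specification of a locally finite graph on a countable vertex set, finite `Λ'`, `Λ` and
coefficients `c`,
`‖μ⁺_{Λ';β,h}(e^{iX}) − ν(e^{iX})‖ ≤ 2 ∑_{x ∈ Λ} |cₓ| (⟨σₓ⟩⁺_{Λ';β,h} − ν(σₓ))`, `X = ∑_{x ∈ Λ} cₓ σₓ`.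
[cite: FriedliVelenik2017, Lemma 6.65 (proof), eq. (6.70), p. 311; Lemma 3.23, p. 112] -/
theorem norm_isingExpect_plus_cexp_sub_integral_le_of_isGibbsMeasure {β : ℝ} (hβ : 0 ≤ β) (h : ℝ)
    {ν : Measure (SpinConfig V)} (hν : IsGibbsMeasure (isingSpecification G β h) ν)
    (Λ' Λ : Finset V) (c : V → ℝ) :
    ‖(∫ σ, cexp (I * ((∑ x ∈ Λ, c x * spinAt x σ : ℝ) : ℂ)) ∂(isingMeasure G Λ' β h .plus)) -
        ∫ σ, cexp (I * ((∑ x ∈ Λ, c x * spinAt x σ : ℝ) : ℂ)) ∂ν‖ ≤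
      2 * ∑ x ∈ Λ, |c x| * (isingExpect G Λ' β h .plus (spinAt x) - ∫ σ, spinAt x σ ∂ν) := by
  haveI := hν.isProbabilityMeasure
  have hPQ : ∀ φ : SpinConfig V → ℝ, Monotone φ → Measurable φ →
      ∫ σ, φ σ ∂ν ≤ ∫ σ, φ σ ∂(isingMeasure G Λ' β h .plus) := fun φ hφ hφm =>
    integral_le_isingExpect_plus_of_isGibbsMeasure G hβ h hν Λ' hφ hφm
  have hint : ∀ (P' : Measure (SpinConfig V)) [IsFiniteMeasure P'] (x : V),
      Integrable (fun σ => |c x| * spinAt x σ) P' := fun P' _ x =>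
    Integrable.of_bound ((measurable_spinAt x).const_mul _).aestronglyMeasurable |c x|
      (Eventually.of_forall fun σ => by
        rw [Real.norm_eq_abs, abs_mul, abs_abs, abs_spinAt, mul_one])
  have key : (∫ σ, ∑ x ∈ Λ, |c x| * spinAt x σ ∂(isingMeasure G Λ' β h .plus)) -
      ∫ σ, ∑ x ∈ Λ, |c x| * spinAt x σ ∂ν =
        ∑ x ∈ Λ, |c x| * (isingExpect G Λ' β h .plus (spinAt x) - ∫ σ, spinAt x σ ∂ν) := by
    rw [integral_finsetSum _ fun x _ => hint _ x, integral_finsetSum _ fun x _ => hint _ x,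
      ← Finset.sum_sub_distrib]
    refine Finset.sum_congr rfl fun x _ => ?_
    rw [integral_const_mul, integral_const_mul, ← mul_sub]
    rfl
  rw [← key]
  exact norm_integral_cexp_sub_le_of_forall_monotone hPQ Λ c

end Ising

/-! ### Generating functionals of box-smeared spin fields -/

/-- The box-smeared spin field is a linear spin observable:
`Φ_δ(f)(σ) = ∑_{x ∈ Λ} (ρ δᵈ f(δx)) σₓ`. (Aizenman–Duminil-Copin 2021, (1.5).) [folklore] -/
theorem spinField_apply_eq_sum_mul_spinAt (Λ : Finset (Site d)) (δ ρ : ℝ) (σ : SpinConfig (Site d))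
    (f : 𝓢(EuclideanSpace ℝ (Fin d), ℝ)) :
    spinField Λ δ ρ σ f = ∑ x ∈ Λ, (ρ * δ ^ d * f (δ • siteToE x)) * spinAt x σ := by
  unfold spinField
  rw [finLatticeField_apply]
  exact Finset.sum_congr rfl fun x _ => by ring

/-- The generating functional of the law of the box-smeared spin field under a measure `R` on spin
configurations is the characteristic function of the linear spin observable
`∑_{x ∈ Λ} (ρ δᵈ f(δx)) σₓ` under `R`. (Glimm–Jaffe §6.1; ADC 2021, §1.2.) [folklore] -/
theorem genFunctional_spinFieldLaw_eq (P : Measure (SpinConfig (Site d))) (Λ : Finset (Site d))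
    (δ ρ : ℝ) (f : 𝓢(EuclideanSpace ℝ (Fin d), ℝ)) :
    genFunctional (spinFieldLaw P Λ δ ρ) f =
      ∫ σ, cexp (I * ((∑ x ∈ Λ, (ρ * δ ^ d * f (δ • siteToE x)) * spinAt x σ : ℝ) : ℂ)) ∂P := by
  have hmeas : AEStronglyMeasurable
      (fun ω : FieldConfig (EuclideanSpace ℝ (Fin d)) => cexp (I * ((ω f : ℝ) : ℂ)))
      (Measure.map (spinField Λ δ ρ) P) :=
    (Complex.continuous_exp.measurable.comp ((Complex.measurable_ofReal.comp
      (measurable_eval f)).const_mul I)).aestronglyMeasurable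
  unfold genFunctional spinFieldLaw
  rw [integral_map (measurable_spinField Λ δ ρ).aemeasurable hmeas]
  refine integral_congr_ae (Eventually.of_forall fun σ => ?_)
  simp only [spinField_apply_eq_sum_mul_spinAt]

/-- **The plus-box law against the law smeared from a DLR state, on generating functionals**
(the FKG–Lipschitz comparison for the rescaled spin field): for `β ≥ 0`, `ν ∈ 𝒢(β, 0)`, a finite
`Λ'` carrying the plus boundary condition, a smearing volume `Λ` and every test function `f`,
`‖S⁺(f) − S^ν(f)‖ ≤ 2 ∑_{x ∈ Λ} |ρ δᵈ f(δx)| (⟨σₓ⟩⁺_{Λ';β,0} − ν(σₓ))`.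
[cite: FriedliVelenik2017, Lemma 6.65 (proof), eq. (6.70), p. 311; Lemma 3.23, p. 112] -/
theorem norm_genFunctional_spinFieldLaw_plus_sub_le {β : ℝ} (hβ : 0 ≤ β)
    {ν : Measure (SpinConfig (Site d))} (hν : ν ∈ isingGibbsMeasures d β 0)
    (Λ' Λ : Finset (Site d)) (δ ρ : ℝ) (f : 𝓢(EuclideanSpace ℝ (Fin d), ℝ)) :
    ‖genFunctional (spinFieldLaw (isingMeasure (zdGraph d) Λ' β 0 .plus) Λ δ ρ) f -
        genFunctional (spinFieldLaw ν Λ δ ρ) f‖ ≤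
      2 * ∑ x ∈ Λ, |ρ * δ ^ d * f (δ • siteToE x)| *
        (isingExpect (zdGraph d) Λ' β 0 .plus (spinAt x) - ∫ σ, spinAt x σ ∂ν) := by
  rw [mem_isingGibbsMeasures_iff] at hν
  rw [genFunctional_spinFieldLaw_eq, genFunctional_spinFieldLaw_eq]
  exact norm_isingExpect_plus_cexp_sub_integral_le_of_isGibbsMeasure (zdGraph d) hβ 0 hν Λ' Λ _

/-- The zero-field DLR states at `0 ≤ β ≤ β_c` (`d ≥ 3`) have zero magnetisation at every site:
they are flip invariant (`measurePreserving_neg_of_mem_isingGibbsMeasures`) and `σₓ` is odd.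
(Aizenman–Duminil-Copin 2021, §6.3, "by flip symmetry".) [folklore] -/
theorem integral_spinAt_eq_zero_of_mem_isingGibbsMeasures (hd : 3 ≤ d) {β : ℝ} (hβ : 0 ≤ β)
    (hβc : β ≤ criticalBeta d) {ν : Measure (SpinConfig (Site d))}
    (hν : ν ∈ isingGibbsMeasures d β 0) (x : Site d) : ∫ σ, spinAt x σ ∂ν = 0 := by
  have hmp := measurePreserving_neg_of_mem_isingGibbsMeasures hd hβ hβc hν
  have h1 := integral_map (μ := ν) hmp.measurable.aemeasurable
    (f := fun σ : SpinConfig (Site d) => spinAt x σ) (measurable_spinAt x).aestronglyMeasurable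
  rw [hmp.map_eq] at h1
  have h2 : ∀ σ : SpinConfig (Site d), spinAt x (-σ) = -spinAt x σ := fun σ => by
    simp [spinAt, Units.val_neg]
  simp_rw [h2, integral_neg] at h1
  linarith

/-- **The plus-box rendering against the infinite-volume one, on generating functionals.** For
`d ≥ 3`, `0 ≤ β ≤ β_c`, the zero-field DLR state `ν ∈ 𝒢(β, 0)`, a box `Λ = box d L` and every
`δ`, `ρ`, `f`: the generating functionals of `isingFieldLaw` (`Φ_δ(f)` under `μ⁺_{Λ;β,0}`) and of
`spinFieldLaw ν Λ δ ρ` (`Φ_δ(f)` under `ν`) differ by at most twice the renormalised plus-boundary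
magnetisation functional `M = ∑_{x ∈ Λ} |ρ δᵈ f(δx)| ⟨σₓ⟩⁺_{Λ;β,0}`.
[cite: FriedliVelenik2017, Lemma 6.65 (proof), eq. (6.70), p. 311; Lemma 3.23, p. 112] -/
theorem norm_genFunctional_isingFieldLaw_sub_spinFieldLaw_le (hd : 3 ≤ d) {β : ℝ} (hβ : 0 ≤ β)
    (hβc : β ≤ criticalBeta d) {ν : Measure (SpinConfig (Site d))}
    (hν : ν ∈ isingGibbsMeasures d β 0) (L : ℝ → ℕ) (δ : ℝ) (ρ : ℝ → ℝ)
    (f : 𝓢(EuclideanSpace ℝ (Fin d), ℝ)) :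
    ‖genFunctional (isingFieldLaw d β L δ ρ) f -
        genFunctional (spinFieldLaw ν (box d (L δ)) δ (ρ δ)) f‖ ≤
      2 * ∑ x ∈ box d (L δ), |ρ δ * δ ^ d * f (δ • siteToE x)| *
        isingExpect (zdGraph d) (box d (L δ)) β 0 .plus (spinAt x) := by
  have h := norm_genFunctional_spinFieldLaw_plus_sub_le hβ hν (box d (L δ)) (box d (L δ)) δ (ρ δ) f
  simp_rw [integral_spinAt_eq_zero_of_mem_isingGibbsMeasures hd hβ hβc hν, sub_zero] at h
  exact h

/-! ### crit-ising.S13 in the plus-box rendering, given negligible boundary magnetisation -/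

/-- **Transfer of the limit in law.** If the plus-box laws `isingFieldLaw d (β δ) L δ ρ` converge
in law to `μ` as `δ → 0⁺` and the renormalised plus-boundary magnetisation functional vanishes,
`M_δ(f) = ∑_{x ∈ box d (L δ)} |ρ(δ) δᵈ f(δx)| ⟨σₓ⟩⁺_{box d (L δ); β(δ), 0} → 0` for every test
function `f`, then the laws of the same field smeared from the zero-field DLR states
`ν δ ∈ 𝒢(β δ, 0)` (`0 ≤ β δ ≤ β_c`, `d ≥ 3`) converge in law to the same `μ`. [folklore] -/
theorem tendstoInLaw_spinFieldLaw_of_tendstoInLaw_isingFieldLaw (hd : 3 ≤ d) {β ρ : ℝ → ℝ}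
    {L : ℝ → ℕ} {ν : ℝ → Measure (SpinConfig (Site d))}
    {μ : Measure (FieldConfig (EuclideanSpace ℝ (Fin d)))}
    (hβ : ∀ δ, 0 < δ → 0 ≤ β δ ∧ β δ ≤ criticalBeta d)
    (hν : ∀ δ, 0 < δ → ν δ ∈ isingGibbsMeasures d (β δ) 0)
    (hM : ∀ f : 𝓢(EuclideanSpace ℝ (Fin d), ℝ), Tendsto (fun δ : ℝ =>
      ∑ x ∈ box d (L δ), |ρ δ * δ ^ d * f (δ • siteToE x)| *
        isingExpect (zdGraph d) (box d (L δ)) (β δ) 0 .plus (spinAt x)) (𝓝[>] 0) (𝓝 0))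
    (hlim : TendstoInLaw (fun δ => isingFieldLaw d (β δ) L δ ρ) (𝓝[>] 0) μ) :
    TendstoInLaw (fun δ => spinFieldLaw (ν δ) (box d (L δ)) δ (ρ δ)) (𝓝[>] 0) μ := by
  intro f
  have hδpos : ∀ᶠ δ in 𝓝[>] (0 : ℝ), 0 < δ := eventually_mem_nhdsWithin
  -- the difference of the two generating functionals tends to zero
  have hdiff : Tendsto (fun δ => genFunctional (isingFieldLaw d (β δ) L δ ρ) f -
      genFunctional (spinFieldLaw (ν δ) (box d (L δ)) δ (ρ δ)) f) (𝓝[>] 0) (𝓝 0) := by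
    rw [tendsto_zero_iff_norm_tendsto_zero]
    have h2 : Tendsto (fun δ : ℝ => 2 * ∑ x ∈ box d (L δ), |ρ δ * δ ^ d * f (δ • siteToE x)| *
        isingExpect (zdGraph d) (box d (L δ)) (β δ) 0 .plus (spinAt x)) (𝓝[>] 0) (𝓝 0) := by
      have h := (hM f).const_mul 2
      rwa [mul_zero] at h
    refine squeeze_zero' (Eventually.of_forall fun δ => norm_nonneg _) ?_ h2
    filter_upwards [hδpos] with δ hδ
    exact norm_genFunctional_isingFieldLaw_sub_spinFieldLaw_le hd (hβ δ hδ).1 (hβ δ hδ).2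
      (hν δ hδ) L δ ρ f
  have h := (hlim f).sub hdiff
  simp only [sub_zero, sub_sub_cancel] at h
  exact h

/-- **Gaussianity of scaling limits in law of the plus-box spin field, `d ≥ 4`, granting the
uniform smallness of the Ursell sum and negligible boundary magnetisation.** For
`0 ≤ β(δ) ≤ β_c`, any `ρ(δ)`, boxes with `δ L(δ) → ∞`: if the renormalised plus-boundary
magnetisation functional `M_δ(f)` vanishes for every test function `f`, every limit in law of
`isingFieldLaw d (β δ) L δ ρ` (the field of `highDim_triviality`, smeared under the finite-volume
plus measure) is a centred Gaussian field — by transfer to the zero-field DLR states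
(`tendstoInLaw_spinFieldLaw_of_tendstoInLaw_isingFieldLaw`, states from `exists_plusMeasure_holds`)
and the infinite-volume theorem `isGaussianField_of_tendstoInLaw_spinFieldLaw_gibbs`.
[cite: AizenmanDuminilCopinAnnals2021, arXiv:1912.07973 Thm 1.2 with Def. 1.1 (p. 4), Prop. 1.4 and p. 6, §6.3 (p. 26)] -/
theorem isGaussianField_of_tendstoInLaw_isingFieldLaw (hd : 4 ≤ d)
    (hU : ∀ r : ℝ, 1 ≤ r → ∀ ε : ℝ, 0 < ε → ∃ L₀ : ℝ, ∀ (β L : ℝ), 0 ≤ β → β ≤ criticalBeta d →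
      L₀ ≤ L → ∀ μ ∈ isingGibbsMeasures d β 0, ursellFourSum μ L r ≤ ε)
    {β ρ : ℝ → ℝ} {L : ℝ → ℕ} {μ : Measure (FieldConfig (EuclideanSpace ℝ (Fin d)))}
    (hβ : ∀ δ, 0 ≤ β δ ∧ β δ ≤ criticalBeta d)
    (hL : Tendsto (fun δ : ℝ => δ * L δ) (𝓝[>] 0) atTop)
    (hM : ∀ f : 𝓢(EuclideanSpace ℝ (Fin d), ℝ), Tendsto (fun δ : ℝ =>
      ∑ x ∈ box d (L δ), |ρ δ * δ ^ d * f (δ • siteToE x)| *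
        isingExpect (zdGraph d) (box d (L δ)) (β δ) 0 .plus (spinAt x)) (𝓝[>] 0) (𝓝 0))
    (hlim : TendstoInLaw (fun δ => isingFieldLaw d (β δ) L δ ρ) (𝓝[>] 0) μ) :
    IsGaussianField μ := by
  -- the zero-field DLR states (the plus states; `𝒢(β, 0)` is a singleton for `β ≤ β_c`)
  let ν : ℝ → Measure (SpinConfig (Site d)) := fun δ =>
    Classical.choose (exists_plusMeasure_holds (d := d) (β := β δ) (h := 0) (hβ δ).1)
  have hν : ∀ δ, 0 < δ → ν δ ∈ isingGibbsMeasures d (β δ) 0 := fun δ _ =>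
    (Classical.choose_spec (exists_plusMeasure_holds (d := d) (β := β δ) (h := 0) (hβ δ).1)).1
  exact isGaussianField_of_tendstoInLaw_spinFieldLaw_gibbs hd hU (fun δ _ => hβ δ) hν hL
    (tendstoInLaw_spinFieldLaw_of_tendstoInLaw_isingFieldLaw (by omega) (fun δ _ => hβ δ) hν hM
      hlim)

/-- **crit-ising.S13, `d ≥ 5`, in the plus-box rendering of `highDim_triviality`, given
negligible boundary magnetisation** (Aizenman, CMP 86 (1982), Prop. 10.1 with (13.1); Fröhlich
1982; Panis 2023, Thm 5.5 — all for the infinite-volume state). Literally the body of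
`Literature.Probability.LatticeModels.highDim_triviality` restricted to `d ≥ 5`, with ONE extra
hypothesis, the vanishing of the renormalised plus-boundary magnetisation functional
`M_δ(f) = ∑_{x ∈ box d (L δ)} |ρ(δ) δᵈ f(δx)| ⟨σₓ⟩⁺_{box d (L δ); β(δ), 0} → 0` (`δ → 0⁺`) for
every test function `f` — the finite-size input, absent from the sources, that separates the
rendered statement (finite-volume plus boxes in a joint limit) from the printed one; given it, the
plus-box laws and the infinite-volume laws have the same limits in law
(`norm_genFunctional_isingFieldLaw_sub_spinFieldLaw_le`) and `highDim_triviality_gibbs_of_five_le`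
applies. Otherwise unconditional (no named fact enters). [cite: AizenmanCMP1982, Prop. 10.1 (p. 28) with (13.1) (p. 39)] [cite: Panis2023Triviality, Thm. 5.5 and Thm. 1.2] -/
theorem highDim_triviality_plus_of_five_le :
    ∀ (d : ℕ) (_ : 5 ≤ d),
      ∀ (ρ : ℝ → ℝ) (L : ℝ → ℕ) (β : ℝ → ℝ)
        (μ : Measure (FieldConfig (EuclideanSpace ℝ (Fin d)))),
        (∀ δ, 0 ≤ β δ ∧ β δ ≤ criticalBeta d) →
        Tendsto (fun δ : ℝ => δ * L δ) (𝓝[>] 0) atTop →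
        (∀ f : 𝓢(EuclideanSpace ℝ (Fin d), ℝ), Tendsto (fun δ : ℝ =>
          ∑ x ∈ box d (L δ), |ρ δ * δ ^ d * f (δ • siteToE x)| *
            isingExpect (zdGraph d) (box d (L δ)) (β δ) 0 .plus (spinAt x)) (𝓝[>] 0) (𝓝 0)) →
        TendstoInLaw (fun δ => isingFieldLaw d (β δ) L δ ρ) (𝓝[>] 0) μ →
        HasBoundedNondegenerateTwoPoint μ → IsGaussianField μ :=
  fun _ hd _ _ _ _ hβ hL hM hlim _ =>
    isGaussianField_of_tendstoInLaw_isingFieldLaw (by omega)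
      (fun _ hr _ hε => ursellFourSum_uniformlySmall_of_five_le hd hr hε) hβ hL hM hlim

/-- **crit-ising.S13, `d ≥ 4`, in the plus-box rendering of `highDim_triviality`, given negligible
boundary magnetisation** (Aizenman–Duminil-Copin, Ann. Math. 194 (2021) = arXiv:1912.07973,
Thm 1.2 with Def. 1.1 (p. 4), Prop. 1.4 (p. 6), for the infinite-volume state). Literally the body
of `Literature.Probability.LatticeModels.highDim_triviality` with the one extra hypothesis
`M_δ(f) → 0` of `highDim_triviality_plus_of_five_le`; proved from the single named fact
`panis_ursellFourSum_le_four` (Panis 2023, Cor. 1.8, entering at `d = 4` only), exactly as the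
corrected infinite-volume form `highDim_triviality_gibbs`.
[cite: AizenmanDuminilCopinAnnals2021, Thm 1.2 with Def. 1.1 (p. 4), §1.3 (p. 5), Prop. 1.4 (p. 6), §6.3 (p. 26)] [cite: Panis2023Triviality, Cor. 1.8 and Thm. 5.5] -/
theorem highDim_triviality_plus (hP₄ : panis_ursellFourSum_le_four) :
    ∀ (d : ℕ) (_ : 4 ≤ d),
      ∀ (ρ : ℝ → ℝ) (L : ℝ → ℕ) (β : ℝ → ℝ)
        (μ : Measure (FieldConfig (EuclideanSpace ℝ (Fin d)))),
        (∀ δ, 0 ≤ β δ ∧ β δ ≤ criticalBeta d) →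
        Tendsto (fun δ : ℝ => δ * L δ) (𝓝[>] 0) atTop →
        (∀ f : 𝓢(EuclideanSpace ℝ (Fin d), ℝ), Tendsto (fun δ : ℝ =>
          ∑ x ∈ box d (L δ), |ρ δ * δ ^ d * f (δ • siteToE x)| *
            isingExpect (zdGraph d) (box d (L δ)) (β δ) 0 .plus (spinAt x)) (𝓝[>] 0) (𝓝 0)) →
        TendstoInLaw (fun δ => isingFieldLaw d (β δ) L δ ρ) (𝓝[>] 0) μ →
        HasBoundedNondegenerateTwoPoint μ → IsGaussianField μ :=
  fun _ hd _ _ _ _ hβ hL hM hlim _ =>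
    isGaussianField_of_tendstoInLaw_isingFieldLaw hd
      (fun r hr ε hε => ursellFourSum_uniformlySmall_of_panis_four hP₄ hd r hr ε hε) hβ hL hM hlim

/-! ### A scalar sufficient condition: the magnetisation at the centre of the half-box

The functional condition `M_δ(f) → 0` follows from two scalar conditions on the parameters:
`ρ(δ) ⟨σ₀⟩⁺_{box d ⌊L(δ)/2⌋; β(δ), 0} → 0` (the renormalised plus magnetisation at the centre of
the half-box vanishes) and `ρ(δ) (δ L(δ))^{-N} → 0` for some `N` (the field strength grows at most
polynomially in the continuum side of the box). Inside the half-box the magnetisation profile is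
dominated by its value at the centre of the half-box (translation covariance and FKG volume
monotonicity of the plus boxes, Friedli–Velenik 2017, Lemma 3.22 and eq. (3.8)); outside it the
Schwartz decay of `f` at distance `≥ δ L(δ)/2` beats the number of sites. -/

section Riemann

/-! #### A Riemann-sum bound for Schwartz functions on `δℤᵈ` (elementary; cf. the private
devices of `LatticeScalarFieldTailProofs`) -/

/-- Telescoping step: `δ/(1+δ(k+1))² ≤ (1+δk)⁻¹ − (1+δ(k+1))⁻¹` for `δ, k ≥ 0`. [folklore] -/
private theorem telescope_step {δ k : ℝ} (hδ : 0 ≤ δ) (hk : 0 ≤ k) :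
    δ / (1 + δ * (k + 1)) ^ 2 ≤ (1 + δ * k)⁻¹ - (1 + δ * (k + 1))⁻¹ := by
  have ha : 0 < 1 + δ * k := by positivity
  have hb : 0 < 1 + δ * (k + 1) := by positivity
  rw [inv_sub_inv ha.ne' hb.ne', show 1 + δ * (k + 1) - (1 + δ * k) = δ by ring, sq]
  exact div_le_div_of_nonneg_left hδ (mul_pos ha hb)
    (mul_le_mul_of_nonneg_right (by nlinarith) hb.le)

/-- Telescoped one-sided sum: `∑_{j<m} δ/(1+δ(j+1))² ≤ 1`. [folklore] -/
private theorem sum_range_wt_le_one {δ : ℝ} (hδ : 0 ≤ δ) (m : ℕ) :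
    ∑ j ∈ Finset.range m, δ / (1 + δ * ((j : ℝ) + 1)) ^ 2 ≤ 1 := by
  have key : ∑ j ∈ Finset.range m, δ / (1 + δ * ((j : ℝ) + 1)) ^ 2 ≤ 1 - (1 + δ * (m : ℝ))⁻¹ := by
    induction m with
    | zero => simp
    | succ m ih =>
      rw [Finset.sum_range_succ, Nat.cast_succ]
      have h := telescope_step hδ (k := (m : ℝ)) (Nat.cast_nonneg m)
      linarith
  have : 0 ≤ (1 + δ * (m : ℝ))⁻¹ := by positivity
  linarith

/-- One-dimensional box sum of the weight `w_δ(n) = δ/(1+δ|n|)²`: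
`∑_{n=-N}^{N} w_δ(n) ≤ δ + 2`. [folklore] -/
private theorem sum_Icc_wt_le {δ : ℝ} (hδ : 0 ≤ δ) (N : ℕ) :
    ∑ n ∈ Finset.Icc (-(N : ℤ)) N, δ / (1 + δ * |(n : ℝ)|) ^ 2 ≤ δ + 2 := by
  classical
  set w : ℤ → ℝ := fun n => δ / (1 + δ * |(n : ℝ)|) ^ 2 with hw
  have hw0 : ∀ n, 0 ≤ w n := fun n => by positivity
  set eP : ℕ → ℤ := fun j => (j : ℤ) + 1 with heP
  set eN : ℕ → ℤ := fun j => -((j : ℤ) + 1) with heN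
  have hcover : Finset.Icc (-(N : ℤ)) N ⊆
      {0} ∪ ((Finset.range N).image eP ∪ (Finset.range N).image eN) := by
    intro n hn
    rw [Finset.mem_Icc] at hn
    rw [Finset.mem_union, Finset.mem_singleton, Finset.mem_union, Finset.mem_image,
      Finset.mem_image]
    rcases lt_trichotomy n 0 with h | h | h
    · exact Or.inr (Or.inr ⟨(-n - 1).toNat, Finset.mem_range.2 (by omega),
        by simp only [heN]; omega⟩)
    · exact Or.inl h
    · exact Or.inr (Or.inl ⟨(n - 1).toNat, Finset.mem_range.2 (by omega),
        by simp only [heP]; omega⟩)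
  have hP : ∑ n ∈ (Finset.range N).image eP, w n ≤ 1 := by
    rw [Finset.sum_image fun a _ b _ h => by simp only [heP] at h; omega]
    have h' : ∀ j ∈ Finset.range N, w (eP j) = δ / (1 + δ * ((j : ℝ) + 1)) ^ 2 := fun j _ => by
      simp only [hw, heP]; push_cast; rw [abs_of_nonneg (by positivity)]
    rw [Finset.sum_congr rfl h']
    exact sum_range_wt_le_one hδ N
  have hN' : ∑ n ∈ (Finset.range N).image eN, w n ≤ 1 := by
    rw [Finset.sum_image fun a _ b _ h => by simp only [heN] at h; omega]
    have h' : ∀ j ∈ Finset.range N, w (eN j) = δ / (1 + δ * ((j : ℝ) + 1)) ^ 2 := fun j _ => by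
      simp only [hw, heN]; push_cast; rw [abs_neg, abs_of_nonneg (by positivity)]
    rw [Finset.sum_congr rfl h']
    exact sum_range_wt_le_one hδ N
  have h0 : ∑ n ∈ ({0} : Finset ℤ), w n = δ := by simp [hw]
  have hunion : ∀ s₁ s₂ : Finset ℤ, ∑ n ∈ s₁ ∪ s₂, w n ≤ ∑ n ∈ s₁, w n + ∑ n ∈ s₂, w n :=
    fun s₁ s₂ => by
      rw [← Finset.sum_union_inter]
      exact le_add_of_nonneg_right (Finset.sum_nonneg fun n _ => hw0 n)
  calc ∑ n ∈ Finset.Icc (-(N : ℤ)) N, w n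
      ≤ ∑ n ∈ {0} ∪ ((Finset.range N).image eP ∪ (Finset.range N).image eN), w n :=
        Finset.sum_le_sum_of_subset_of_nonneg hcover fun n _ _ => hw0 n
    _ ≤ ∑ n ∈ ({0} : Finset ℤ), w n +
          (∑ n ∈ (Finset.range N).image eP, w n + ∑ n ∈ (Finset.range N).image eN, w n) :=
        (hunion _ _).trans (add_le_add le_rfl (hunion _ _))
    _ ≤ δ + 2 := by rw [h0]; linarith

/-- Box sum of the product weight `W_δ(x) = ∏ᵢ w_δ(xᵢ)`: `∑_{x ∈ box d N} W_δ(x) ≤ (δ+2)ᵈ`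
(`Finset.prod_univ_sum`). [folklore] -/
private theorem sum_box_wtd_le {δ : ℝ} (hδ : 0 ≤ δ) (N : ℕ) :
    ∑ x ∈ box d N, ∏ i, δ / (1 + δ * |(x i : ℝ)|) ^ 2 ≤ (δ + 2) ^ d := by
  have h : ∑ x ∈ box d N, ∏ i, δ / (1 + δ * |(x i : ℝ)|) ^ 2 =
      ∏ _i : Fin d, ∑ n ∈ Finset.Icc (-(N : ℤ)) N, δ / (1 + δ * |(n : ℝ)|) ^ 2 := by
    rw [box]
    exact (Finset.prod_univ_sum (fun _ : Fin d => Finset.Icc (-(N : ℤ)) N)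
      (fun _ n => δ / (1 + δ * |(n : ℝ)|) ^ 2)).symm
  rw [h, Finset.prod_const, Finset.card_univ, Fintype.card_fin]
  exact pow_le_pow_left₀ (Finset.sum_nonneg fun n _ => by positivity) (sum_Icc_wt_le hδ N) d

/-- Product-form decay of a Schwartz function on `ℝᵈ`: `∏ᵢ (1+|yᵢ|)² |f(y)| ≤ M`. [folklore] -/
private theorem schwartz_prod_decay (f : 𝓢(EuclideanSpace ℝ (Fin d), ℝ)) :
    ∃ M : ℝ, 0 ≤ M ∧ ∀ y : EuclideanSpace ℝ (Fin d), (∏ i, (1 + |y i|) ^ 2) * |f y| ≤ M := by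
  obtain ⟨M, hM⟩ : ∃ M : ℝ, ∀ y : EuclideanSpace ℝ (Fin d),
      (1 + ‖y‖) ^ (2 * d) * |f y| ≤ M := by
    refine ⟨2 ^ (2 * d) *
      (Finset.Iic (2 * d, 0)).sup (fun m => SchwartzMap.seminorm ℝ m.1 m.2) f, fun y => ?_⟩
    have h := SchwartzMap.one_add_le_sup_seminorm_apply (𝕜 := ℝ) (m := (2 * d, 0))
      (k := 2 * d) (n := 0) le_rfl le_rfl f y
    rwa [norm_iteratedFDeriv_zero, Real.norm_eq_abs] at h
  refine ⟨M, le_trans (by positivity) (hM 0), fun y => le_trans ?_ (hM y)⟩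
  apply mul_le_mul_of_nonneg_right _ (abs_nonneg _)
  calc ∏ i, (1 + |y i|) ^ 2 ≤ ∏ _i : Fin d, (1 + ‖y‖) ^ 2 := by
        refine Finset.prod_le_prod (fun i _ => by positivity) fun i _ => ?_
        have hyi : |y i| ≤ ‖y‖ := by simpa using PiLp.norm_apply_le y i
        exact pow_le_pow_left₀ (by positivity) (by linarith) 2
    _ = (1 + ‖y‖) ^ (2 * d) := by
        rw [Finset.prod_const, Finset.card_univ, Fintype.card_fin, ← pow_mul]

/-- The pointwise bound `δᵈ |f(δx)| ≤ M W_δ(x)`. [folklore] -/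
private theorem pow_mul_abs_le_wtd {δ M : ℝ} (hδ : 0 < δ)
    {f : 𝓢(EuclideanSpace ℝ (Fin d), ℝ)}
    (hM : ∀ y : EuclideanSpace ℝ (Fin d), (∏ i, (1 + |y i|) ^ 2) * |f y| ≤ M) (x : Site d) :
    δ ^ d * |f (δ • siteToE x)| ≤ M * ∏ i, δ / (1 + δ * |(x i : ℝ)|) ^ 2 := by
  set P : ℝ := ∏ i, (1 + δ * |(x i : ℝ)|) ^ 2 with hP
  have hP0 : 0 < P := by positivity
  have hwtd : ∏ i, δ / (1 + δ * |(x i : ℝ)|) ^ 2 = δ ^ d / P := by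
    rw [hP, Finset.prod_div_distrib, Finset.prod_const, Finset.card_univ, Fintype.card_fin]
  have hfy : P * |f (δ • siteToE x)| ≤ M := by
    have h := hM (δ • siteToE x)
    have hcoord : ∀ i, |(δ • siteToE x) i| = δ * |(x i : ℝ)| := fun i => by
      rw [PiLp.smul_apply, siteToE_apply, smul_eq_mul, abs_mul, abs_of_pos hδ]
    simp only [hcoord] at h
    exact h
  calc δ ^ d * |f (δ • siteToE x)| = δ ^ d / P * (P * |f (δ • siteToE x)|) := by
        field_simp
    _ ≤ δ ^ d / P * M := mul_le_mul_of_nonneg_left hfy (by positivity)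
    _ = M * ∏ i, δ / (1 + δ * |(x i : ℝ)|) ^ 2 := by rw [hwtd, mul_comm]

/-- **Riemann sums of a Schwartz function over `δℤᵈ` are bounded**: there is `C = C(f)` with
`δᵈ ∑_{x ∈ box d N} |f(δx)| ≤ C` for all `0 < δ ≤ 1` and all `N` (Glimm–Jaffe 1987, §9.5, the
lattice inner product `∑ δᵈ f(x) φ(x)`; elementary, via `∏ᵢ (1+|yᵢ|)² |f(y)| ≤ M` and the
one-dimensional bound `∑ₙ δ/(1+δ|n|)² ≤ δ + 2`). [cite: GlimmJaffe1987, §9.5–9.6] -/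
theorem exists_bound_sum_box_abs_schwartz (f : 𝓢(EuclideanSpace ℝ (Fin d), ℝ)) :
    ∃ C : ℝ, 0 ≤ C ∧ ∀ δ : ℝ, 0 < δ → δ ≤ 1 → ∀ N : ℕ,
      δ ^ d * ∑ x ∈ box d N, |f (δ • siteToE x)| ≤ C := by
  obtain ⟨M, hM0, hM⟩ := schwartz_prod_decay f
  refine ⟨M * 3 ^ d, by positivity, fun δ hδ hδ1 N => ?_⟩
  calc δ ^ d * ∑ x ∈ box d N, |f (δ • siteToE x)|
      = ∑ x ∈ box d N, δ ^ d * |f (δ • siteToE x)| := Finset.mul_sum _ _ _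
    _ ≤ ∑ x ∈ box d N, M * ∏ i, δ / (1 + δ * |(x i : ℝ)|) ^ 2 :=
        Finset.sum_le_sum fun x _ => pow_mul_abs_le_wtd hδ hM x
    _ = M * ∑ x ∈ box d N, ∏ i, δ / (1 + δ * |(x i : ℝ)|) ^ 2 := (Finset.mul_sum _ _ _).symm
    _ ≤ M * (δ + 2) ^ d := mul_le_mul_of_nonneg_left (sum_box_wtd_le hδ.le N) hM0
    _ ≤ M * 3 ^ d :=
        mul_le_mul_of_nonneg_left (pow_le_pow_left₀ (by positivity) (by linarith) d) hM0

end Riemann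

/-! #### The plus magnetisation profile inside the half-box -/

/-- `0 ≤ ⟨σₓ⟩⁺_{Λ;β,0}` for `x ∈ Λ`, `β ≥ 0` (Griffiths' first inequality, Friedli–Velenik 2017,
Thm. 3.20, eq. (3.21); the tree's `GKSInequalities.gks_one_holds`). [cite: FriedliVelenik2017, Thm. 3.20, eq. (3.21)] -/
theorem isingExpect_plus_spinAt_nonneg {β : ℝ} (hβ : 0 ≤ β) {Λ : Finset (Site d)} {x : Site d}
    (hx : x ∈ Λ) : 0 ≤ isingExpect (zdGraph d) Λ β 0 .plus (spinAt x) := by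
  have hs : spinProduct ({x} : Finset (Site d)) = spinAt x := by funext s; simp [spinProduct]
  have h1 := GKSInequalities.gks_one_holds (zdGraph d) (Λ := Λ) (A := {x}) (β := β) (h := 0)
    (bc := .plus) hβ le_rfl (Or.inr rfl) (Finset.singleton_subset_iff.2 hx)
  rwa [isingCorr, hs] at h1

/-- `⟨σₓ⟩⁺_{Λ;β,h} ≤ 1` (`|σₓ| = 1`; Friedli–Velenik 2017, §3.6.1). [folklore] -/
theorem isingExpect_plus_spinAt_le_one (β h : ℝ) (Λ : Finset (Site d)) (x : Site d) :
    isingExpect (zdGraph d) Λ β h .plus (spinAt x) ≤ 1 := by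
  have hs : spinProduct ({x} : Finset (Site d)) = spinAt x := by funext s; simp [spinProduct]
  have h1 := abs_isingCorr_le_one (zdGraph d) Λ β h .plus {x}
  rw [isingCorr, hs] at h1
  exact (le_abs_self _).trans h1

/-- **The plus magnetisation inside the half-box is dominated by the magnetisation at the centre
of the half-box**: for `β ≥ 0`, any `h`, `2H ≤ L` and `x ∈ box d H`,
`⟨σₓ⟩⁺_{box d L; β,h} ≤ ⟨σ₀⟩⁺_{box d H; β,h}`. Indeed the translated box `box d (L − ‖x‖_∞) + x`
lies inside `box d L`, and `box d H ⊆ box d (L − ‖x‖_∞)`, so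
`⟨σₓ⟩⁺_{box d L} ≤ ⟨σₓ⟩⁺_{box d (L−‖x‖_∞) + x} = ⟨σ₀⟩⁺_{box d (L−‖x‖_∞)} ≤ ⟨σ₀⟩⁺_{box d H}` by FKG
volume monotonicity of plus expectations of the nondecreasing `σ_y` (Friedli–Velenik 2017,
Lemma 3.22; `isingExpect_plus_anti_volume_of_fkg`) and translation covariance of the plus boxes
(eq. (3.8) reindexed; `isingExpect_plus_shift`). [cite: FriedliVelenik2017, Lemma 3.22 (p. 111) and §3.1, eq. (3.8)] -/
theorem isingExpect_plus_spinAt_le_center {β : ℝ} (hβ : 0 ≤ β) (h : ℝ) {L H : ℕ}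
    (hHL : 2 * H ≤ L) {x : Site d} (hx : x ∈ box d H) :
    isingExpect (zdGraph d) (box d L) β h .plus (spinAt x) ≤
      isingExpect (zdGraph d) (box d H) β h .plus (spinAt 0) := by
  set m : ℕ := Site.supNorm x with hm
  have hmH : m ≤ H := mem_box_iff_supNorm_le.1 hx
  have hmL : m ≤ L := by omega
  have hanti : ∀ {Λ₁ Λ₂ : Finset (Site d)}, Λ₁ ⊆ Λ₂ → ∀ y : Site d,
      isingExpect (zdGraph d) Λ₂ β h .plus (spinAt y) ≤
        isingExpect (zdGraph d) Λ₁ β h .plus (spinAt y) := fun h12 y =>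
    isingExpect_plus_anti_volume_of_fkg (zdGraph d) (ising_fkg_holds _) hβ h h12 (spinAt_mono y)
      (measurable_spinAt y)
  have hsub1 : (box d (L - m)).map (Site.shift x).toEmbedding ⊆ box d L := by
    have h' := map_shift_box_subset (d := d) (L - m) x
    rwa [← hm, Nat.sub_add_cancel hmL] at h'
  have hshift : isingExpect (zdGraph d) ((box d (L - m)).map (Site.shift x).toEmbedding) β h .plus
      (spinAt x) = isingExpect (zdGraph d) (box d (L - m)) β h .plus (spinAt 0) := by
    rw [isingExpect_plus_shift (box d (L - m)) x β h (measurable_spinAt x)]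
    congr 1
    funext σ
    simp [spinAt, LatticeModels.configShift_apply]
  have hsub2 : box d H ⊆ box d (L - m) := box_mono d (by omega)
  calc isingExpect (zdGraph d) (box d L) β h .plus (spinAt x)
      ≤ isingExpect (zdGraph d) ((box d (L - m)).map (Site.shift x).toEmbedding) β h .plus
          (spinAt x) := hanti hsub1 x
    _ = isingExpect (zdGraph d) (box d (L - m)) β h .plus (spinAt 0) := hshift
    _ ≤ isingExpect (zdGraph d) (box d H) β h .plus (spinAt 0) := hanti hsub2 0

/-! #### The scalar sufficient condition -/

/-- **Negligible boundary magnetisation from the centre of the half-box.** For `β(δ) ≥ 0` and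
boxes with `δ L(δ) → ∞`: if `ρ(δ) ⟨σ₀⟩⁺_{box d ⌊L(δ)/2⌋; β(δ), 0} → 0` and
`ρ(δ) (δ L(δ))^{-N} → 0` for some `N`, then the renormalised plus-boundary magnetisation
functional vanishes, `M_δ(f) = ∑_{x ∈ box d (L δ)} |ρ(δ) δᵈ f(δx)| ⟨σₓ⟩⁺_{box d (L δ); β(δ), 0} → 0`,
for every test function `f`. Inside `box d ⌊L/2⌋` use `isingExpect_plus_spinAt_le_center` and
the Riemann-sum bound `exists_bound_sum_box_abs_schwartz`; outside, `⟨σₓ⟩⁺ ≤ 1`, the Schwartz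
decay `‖u‖^{d+N} |f(u)| ≤ C` at `‖δx‖ ≥ δ L/2` and `|box d L| = (2L+1)ᵈ`. [folklore] -/
theorem tendsto_plusBoundaryMagnetization_of_center {β ρ : ℝ → ℝ} {L : ℝ → ℕ}
    (hβ : ∀ δ, 0 < δ → 0 ≤ β δ)
    (hL : Tendsto (fun δ : ℝ => δ * L δ) (𝓝[>] 0) atTop)
    (h1 : Tendsto (fun δ : ℝ => ρ δ *
      isingExpect (zdGraph d) (box d (L δ / 2)) (β δ) 0 .plus (spinAt 0)) (𝓝[>] 0) (𝓝 0))
    (h2 : ∃ N : ℕ, Tendsto (fun δ : ℝ => ρ δ / (δ * L δ) ^ N) (𝓝[>] 0) (𝓝 0))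
    (f : 𝓢(EuclideanSpace ℝ (Fin d), ℝ)) :
    Tendsto (fun δ : ℝ => ∑ x ∈ box d (L δ), |ρ δ * δ ^ d * f (δ • siteToE x)| *
        isingExpect (zdGraph d) (box d (L δ)) (β δ) 0 .plus (spinAt x)) (𝓝[>] 0) (𝓝 0) := by
  obtain ⟨C₁, hC₁0, hC₁⟩ := exists_bound_sum_box_abs_schwartz f
  obtain ⟨N, hN⟩ := h2
  set k : ℕ := d + N with hk
  set C₂ : ℝ := SchwartzMap.seminorm ℝ k 0 f with hC₂
  have hC₂0 : 0 ≤ C₂ := apply_nonneg _ _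
  have hdecay : ∀ u : EuclideanSpace ℝ (Fin d), ‖u‖ ^ k * |f u| ≤ C₂ := fun u => by
    have h := SchwartzMap.le_seminorm ℝ k 0 f u
    rwa [norm_iteratedFDeriv_zero, Real.norm_eq_abs] at h
  -- the magnetisation at the centre of the half-box and the majorant `B`
  set a : ℝ → ℝ := fun δ =>
    isingExpect (zdGraph d) (box d (L δ / 2)) (β δ) 0 .plus (spinAt 0) with ha
  set B : ℝ → ℝ := fun δ =>
    C₁ * |ρ δ * a δ| + 3 ^ d * 2 ^ k * C₂ * |ρ δ / (δ * L δ) ^ N| with hB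
  have hBt : Tendsto B (𝓝[>] 0) (𝓝 0) := by
    have t1 : Tendsto (fun δ => C₁ * |ρ δ * a δ|) (𝓝[>] 0) (𝓝 0) := by
      have h := ((continuous_abs.tendsto 0).comp h1).const_mul C₁
      rw [abs_zero, mul_zero] at h
      exact h
    have t2 : Tendsto (fun δ => 3 ^ d * 2 ^ k * C₂ * |ρ δ / (δ * L δ) ^ N|) (𝓝[>] 0) (𝓝 0) := by
      have h := ((continuous_abs.tendsto 0).comp hN).const_mul (3 ^ d * 2 ^ k * C₂)
      rw [abs_zero, mul_zero] at h
      exact h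
    have h := t1.add t2
    rw [add_zero] at h
    exact h
  have hδpos : ∀ᶠ δ in 𝓝[>] (0 : ℝ), 0 < δ := eventually_mem_nhdsWithin
  have hδle : ∀ᶠ δ in 𝓝[>] (0 : ℝ), δ ≤ 1 :=
    (eventually_le_nhds one_pos).filter_mono nhdsWithin_le_nhds
  have ht1 : ∀ᶠ δ in 𝓝[>] (0 : ℝ), 1 ≤ δ * L δ := hL.eventually_ge_atTop 1
  refine squeeze_zero' ?_ ?_ hBt
  · filter_upwards [hδpos] with δ hδ
    exact Finset.sum_nonneg fun x hx =>
      mul_nonneg (abs_nonneg _) (isingExpect_plus_spinAt_nonneg (hβ δ hδ) hx)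
  filter_upwards [hδpos, hδle, ht1] with δ hδ hδ1 ht
  -- notation for this `δ`
  set Lδ : ℕ := L δ with hLδ
  set H : ℕ := Lδ / 2 with hH
  set t : ℝ := δ * Lδ with htdef
  have hHL : 2 * H ≤ Lδ := by omega
  have ht0 : 0 < t := one_pos.trans_le ht
  have hδt : δ ≤ t := hδ1.trans ht
  have hHt : t / 2 ≤ δ * ((H : ℝ) + 1) := by
    have h' : (Lδ : ℝ) ≤ 2 * ((H : ℝ) + 1) := by
      have h'' : Lδ ≤ 2 * (H + 1) := by omega
      exact_mod_cast h''
    rw [htdef]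
    nlinarith [hδ.le]
  -- (i) the inner half-box
  have ha0 : 0 ≤ a δ :=
    isingExpect_plus_spinAt_nonneg (hβ δ hδ) (Λ := box d H) (x := 0) (by simp [mem_box])
  have hinner : ∑ x ∈ box d H, |ρ δ * δ ^ d * f (δ • siteToE x)| *
      isingExpect (zdGraph d) (box d Lδ) (β δ) 0 .plus (spinAt x) ≤ C₁ * |ρ δ * a δ| := by
    calc ∑ x ∈ box d H, |ρ δ * δ ^ d * f (δ • siteToE x)| *
          isingExpect (zdGraph d) (box d Lδ) (β δ) 0 .plus (spinAt x)
        ≤ ∑ x ∈ box d H, |ρ δ * δ ^ d * f (δ • siteToE x)| * a δ :=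
          Finset.sum_le_sum fun x hx => mul_le_mul_of_nonneg_left
            (isingExpect_plus_spinAt_le_center (hβ δ hδ) 0 hHL hx) (abs_nonneg _)
      _ = ∑ x ∈ box d H, |ρ δ| * a δ * (δ ^ d * |f (δ • siteToE x)|) :=
          Finset.sum_congr rfl fun x _ => by
            rw [abs_mul, abs_mul, abs_of_pos (pow_pos hδ d)]
            ring
      _ = |ρ δ| * a δ * (δ ^ d * ∑ x ∈ box d H, |f (δ • siteToE x)|) := by
          rw [← Finset.mul_sum, ← Finset.mul_sum]
      _ ≤ |ρ δ| * a δ * C₁ :=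
          mul_le_mul_of_nonneg_left (hC₁ δ hδ hδ1 H) (mul_nonneg (abs_nonneg _) ha0)
      _ = C₁ * |ρ δ * a δ| := by rw [abs_mul, abs_of_nonneg ha0]; ring
  -- (ii) the outer shell: Schwartz decay beats the number of sites
  have hfx : ∀ x ∈ box d Lδ \ box d H, |f (δ • siteToE x)| ≤ C₂ * 2 ^ k / t ^ k := by
    intro x hx
    rw [Finset.mem_sdiff, mem_box (L := H)] at hx
    obtain ⟨i, hi⟩ := not_forall.1 hx.2
    have hi' : (H : ℤ) + 1 ≤ |x i| := by
      rw [le_abs]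
      omega
    have hiR : (H : ℝ) + 1 ≤ |(x i : ℝ)| := by
      have h' : (((H : ℤ) + 1 : ℤ) : ℝ) ≤ ((|x i| : ℤ) : ℝ) := by exact_mod_cast hi'
      simpa [Int.cast_abs] using h'
    have hnorm : t / 2 ≤ ‖δ • siteToE x‖ :=
      calc t / 2 ≤ δ * ((H : ℝ) + 1) := hHt
        _ ≤ δ * |(x i : ℝ)| := mul_le_mul_of_nonneg_left hiR hδ.le
        _ = |(δ • siteToE x) i| := by
            rw [PiLp.smul_apply, siteToE_apply, smul_eq_mul, abs_mul, abs_of_pos hδ]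
        _ ≤ ‖δ • siteToE x‖ := by simpa using PiLp.norm_apply_le (δ • siteToE x) i
    have hpow : (t / 2) ^ k ≤ ‖δ • siteToE x‖ ^ k := pow_le_pow_left₀ (by positivity) hnorm k
    have hk' : (t / 2) ^ k * |f (δ • siteToE x)| ≤ C₂ :=
      (mul_le_mul_of_nonneg_right hpow (abs_nonneg _)).trans (hdecay _)
    have htk : 0 < (t / 2) ^ k := by positivity
    calc |f (δ • siteToE x)| = (t / 2) ^ k * |f (δ • siteToE x)| / (t / 2) ^ k := by
          field_simp
      _ ≤ C₂ / (t / 2) ^ k := div_le_div_of_nonneg_right hk' htk.le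
      _ = C₂ * 2 ^ k / t ^ k := by rw [div_pow]; field_simp
  have houter : ∑ x ∈ box d Lδ \ box d H, |ρ δ * δ ^ d * f (δ • siteToE x)| *
      isingExpect (zdGraph d) (box d Lδ) (β δ) 0 .plus (spinAt x) ≤
        3 ^ d * 2 ^ k * C₂ * |ρ δ / (δ * L δ) ^ N| := by
    calc ∑ x ∈ box d Lδ \ box d H, |ρ δ * δ ^ d * f (δ • siteToE x)| *
          isingExpect (zdGraph d) (box d Lδ) (β δ) 0 .plus (spinAt x)
        ≤ ∑ x ∈ box d Lδ \ box d H, |ρ δ| * δ ^ d * (C₂ * 2 ^ k / t ^ k) :=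
          Finset.sum_le_sum fun x hx => by
            have hxL : x ∈ box d Lδ := (Finset.mem_sdiff.1 hx).1
            have hm1 := isingExpect_plus_spinAt_le_one (β δ) 0 (box d Lδ) x
            have hm0 := isingExpect_plus_spinAt_nonneg (hβ δ hδ) hxL
            rw [abs_mul, abs_mul, abs_of_pos (pow_pos hδ d)]
            calc |ρ δ| * δ ^ d * |f (δ • siteToE x)| *
                  isingExpect (zdGraph d) (box d Lδ) (β δ) 0 .plus (spinAt x)
                ≤ |ρ δ| * δ ^ d * |f (δ • siteToE x)| * 1 :=
                  mul_le_mul_of_nonneg_left hm1 (by positivity)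
              _ ≤ |ρ δ| * δ ^ d * (C₂ * 2 ^ k / t ^ k) := by
                  rw [mul_one]
                  exact mul_le_mul_of_nonneg_left (hfx x hx) (by positivity)
      _ = ((box d Lδ \ box d H).card : ℝ) * (|ρ δ| * δ ^ d * (C₂ * 2 ^ k / t ^ k)) := by
          rw [Finset.sum_const, nsmul_eq_mul]
      _ ≤ ((box d Lδ).card : ℝ) * (|ρ δ| * δ ^ d * (C₂ * 2 ^ k / t ^ k)) :=
          mul_le_mul_of_nonneg_right (by exact_mod_cast Finset.card_le_card Finset.sdiff_subset)
            (by positivity)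
      _ = ((2 * (Lδ : ℝ) + 1) * δ) ^ d * (|ρ δ| * (C₂ * 2 ^ k / t ^ k)) := by
          rw [card_box, mul_pow (2 * (Lδ : ℝ) + 1) δ d]; push_cast; ring
      _ ≤ (3 * t) ^ d * (|ρ δ| * (C₂ * 2 ^ k / t ^ k)) := by
          have h3 : (2 * (Lδ : ℝ) + 1) * δ ≤ 3 * t := by rw [htdef]; nlinarith [hδ.le]
          exact mul_le_mul_of_nonneg_right (pow_le_pow_left₀ (by positivity) h3 d) (by positivity)
      _ = 3 ^ d * 2 ^ k * C₂ * (|ρ δ| / t ^ N) := by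
          rw [hk, mul_pow]
          field_simp
          ring
      _ = 3 ^ d * 2 ^ k * C₂ * |ρ δ / (δ * L δ) ^ N| := by
          rw [abs_div, abs_of_pos (pow_pos ht0 N)]
  -- (iii) assemble
  calc ∑ x ∈ box d Lδ, |ρ δ * δ ^ d * f (δ • siteToE x)| *
        isingExpect (zdGraph d) (box d Lδ) (β δ) 0 .plus (spinAt x)
      = ∑ x ∈ box d Lδ \ box d H, |ρ δ * δ ^ d * f (δ • siteToE x)| *
            isingExpect (zdGraph d) (box d Lδ) (β δ) 0 .plus (spinAt x) +
          ∑ x ∈ box d H, |ρ δ * δ ^ d * f (δ • siteToE x)| *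
            isingExpect (zdGraph d) (box d Lδ) (β δ) 0 .plus (spinAt x) :=
        (Finset.sum_sdiff (box_mono d (by omega : H ≤ Lδ))).symm
    _ ≤ 3 ^ d * 2 ^ k * C₂ * |ρ δ / (δ * L δ) ^ N| + C₁ * |ρ δ * a δ| := add_le_add houter hinner
    _ = B δ := by simp only [hB]; ring

/-- **crit-ising.S13, `d ≥ 5`, in the plus-box rendering of `highDim_triviality`, given that
the renormalised magnetisation at the centre of the half-box vanishes** (Aizenman 1982,
Prop. 10.1 with (13.1); Fröhlich 1982; Panis 2023, Thm 5.5, for the infinite-volume state).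
The body of `Literature.Probability.LatticeModels.highDim_triviality` restricted to `d ≥ 5`, with
two extra scalar hypotheses on the parameters — `ρ(δ) ⟨σ₀⟩⁺_{box d ⌊L(δ)/2⌋; β(δ), 0} → 0` and
`ρ(δ) (δ L(δ))^{-N} → 0` for some `N` (`δ → 0⁺`) — under which the plus boundary condition of
the rendered boxes is invisible at the smearing scale
(`tendsto_plusBoundaryMagnetization_of_center`) and `highDim_triviality_plus_of_five_le`
applies. Otherwise unconditional (no named fact enters). [cite: AizenmanCMP1982, Prop. 10.1 (p. 28) with (13.1) (p. 39)] [cite: Panis2023Triviality, Thm. 5.5 and Thm. 1.2] -/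
theorem highDim_triviality_plus_of_center_of_five_le :
    ∀ (d : ℕ) (_ : 5 ≤ d),
      ∀ (ρ : ℝ → ℝ) (L : ℝ → ℕ) (β : ℝ → ℝ)
        (μ : Measure (FieldConfig (EuclideanSpace ℝ (Fin d)))),
        (∀ δ, 0 ≤ β δ ∧ β δ ≤ criticalBeta d) →
        Tendsto (fun δ : ℝ => δ * L δ) (𝓝[>] 0) atTop →
        Tendsto (fun δ : ℝ => ρ δ *
          isingExpect (zdGraph d) (box d (L δ / 2)) (β δ) 0 .plus (spinAt 0)) (𝓝[>] 0) (𝓝 0) →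
        (∃ N : ℕ, Tendsto (fun δ : ℝ => ρ δ / (δ * L δ) ^ N) (𝓝[>] 0) (𝓝 0)) →
        TendstoInLaw (fun δ => isingFieldLaw d (β δ) L δ ρ) (𝓝[>] 0) μ →
        HasBoundedNondegenerateTwoPoint μ → IsGaussianField μ :=
  fun d hd ρ L β μ hβ hL h1 h2 hlim h2pt =>
    highDim_triviality_plus_of_five_le d hd ρ L β μ hβ hL
      (tendsto_plusBoundaryMagnetization_of_center (fun δ _ => (hβ δ).1) hL h1 h2) hlim h2pt

/-- **crit-ising.S13, `d ≥ 4`, in the plus-box rendering of `highDim_triviality`, given that the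
renormalised magnetisation at the centre of the half-box vanishes** (Aizenman–Duminil-Copin
2021, Thm 1.2 with Def. 1.1 (p. 4), Prop. 1.4 (p. 6), for the infinite-volume state): as
`highDim_triviality_plus_of_center_of_five_le`, for `d ≥ 4`, from the single named fact
`panis_ursellFourSum_le_four` (entering at `d = 4` only).
[cite: AizenmanDuminilCopinAnnals2021, Thm 1.2 with Def. 1.1 (p. 4), §1.3 (p. 5), Prop. 1.4 (p. 6), §6.3 (p. 26)] [cite: Panis2023Triviality, Cor. 1.8 and Thm. 5.5] -/
theorem highDim_triviality_plus_of_center (hP₄ : panis_ursellFourSum_le_four) :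
    ∀ (d : ℕ) (_ : 4 ≤ d),
      ∀ (ρ : ℝ → ℝ) (L : ℝ → ℕ) (β : ℝ → ℝ)
        (μ : Measure (FieldConfig (EuclideanSpace ℝ (Fin d)))),
        (∀ δ, 0 ≤ β δ ∧ β δ ≤ criticalBeta d) →
        Tendsto (fun δ : ℝ => δ * L δ) (𝓝[>] 0) atTop →
        Tendsto (fun δ : ℝ => ρ δ *
          isingExpect (zdGraph d) (box d (L δ / 2)) (β δ) 0 .plus (spinAt 0)) (𝓝[>] 0) (𝓝 0) →
        (∃ N : ℕ, Tendsto (fun δ : ℝ => ρ δ / (δ * L δ) ^ N) (𝓝[>] 0) (𝓝 0)) →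
        TendstoInLaw (fun δ => isingFieldLaw d (β δ) L δ ρ) (𝓝[>] 0) μ →
        HasBoundedNondegenerateTwoPoint μ → IsGaussianField μ :=
  fun d hd ρ L β μ hβ hL h1 h2 hlim h2pt =>
    highDim_triviality_plus hP₄ d hd ρ L β μ hβ hL
      (tendsto_plusBoundaryMagnetization_of_center (fun δ _ => (hβ δ).1) hL h1 h2) hlim h2pt

end Literature.Probability.LatticeModels

end
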